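import Summits.Schanuel.Schanuel.Theorems.RootDecomp1BFactDischarge01
import Summits.Schanuel.Schanuel.Theorems.RootDecomp1BTwoStorey04

/-!
# RootDecomp1BExplicitPair — lens 4, generation 44 «EXPLICIT JU PAIR (ρ_J, σ_J) BY A MEASURE-FREE INDEPENDENCE CRITERION» (CLAIM L2220, ACK/CHECKLIST B-g44 L2225, NODE L2248 / REQUEST L2249, writer re-check L2254, critic VERDICT L2251: CLEARED — THEOREM ×1 «measure-free nested-approximation independence criterion + first explicit JU member»; RULE B-R30; lens-4 tally THEOREM ×8 + CELL ×4) — part 1 (RootDecomp1BExplicitPair01): K doc + §1 lower bound near a rational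

(lens-4 g44 HOME kernel K = HOME/decomp-schanuel-lens-4/g44/ExplicitPair.lean c215aab4…, 1070 l, import tree `…RootDecomp1BFactDischarge01` ONLY; P ExplicitPairProbe.lean 61d4e775… rc 0, C ExplicitPairCtrl.lean ef32d495… rc 1 = exactly the 12 planted errors. Port by census-1 gen 19 as `RootDecomp1BExplicitPair01`–`04` (after TwoStorey01–04, as sequenced): 01 = K doc + §1 the ONE new estimate «lower bound near a rational» (`shiftCoeff`, `qpow_mul_aeval_eq`, `exists_shiftCoeff_ne_zero`, `abs_shiftCoeff_le`, `lowest_term_dominates`, `eval_lower_near_rat`); 02 = §2 THE CRITERION (`NestedLiouville`, `algebraicIndependent_of_nestedLiouville`, sequence form `algebraicIndependent_of_dominated_approx`, the checklist's weighted shape `…_weighted`); 03 = §3 THE EXPLICIT PAIR (`rhoJ`/`sigmaJ` = even/odd sub-series of the tree tower `uTow`, `rhoJ_add_sigmaJ : rhoJ + sigmaJ = rhoU`, `nestedLiouville_rhoJ_sigmaJ`, `algebraicIndependent_rhoJ_sigmaJ`, `dominated_approx_rhoJ_sigmaJ`, `jointlyUltra_rhoJ_sigmaJ`, `JU_rhoJ_sigmaJ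 : JU rhoJ sigmaJ` against the TREE class, `exists_JU_explicit`); 04 = §4 each coordinate ultra-Liouville (tree `UltraLiouville`) ⟹ storey-two cells at `(1, ρ_J)`, `(1, σ_J)` BY NAME + §5 controls proved (`not_nestedLiouville_self`, `not_nestedLiouville_sq`, `frozen_level_insufficient`).
PORT EDITS: `import …RootDecomp1BTwoStorey04` added and K's LOCAL COPIES of `UltraLiouville₂`, `JU` (§3.6) and of g43's `not_algebraicIndependent_sq` DELETED — the tree decls of `RootDecomp1BTwoStorey02/04` are used BY NAME (verdict condition); the file-wide linter option dropped; 23 one-line docstrings added to §3 helper lemmas; 8 generic helpers made PRIVATE (dedup-safety: `aeval_ofReal_int` has name-and-statement twins in RadixCell04 / AlgFrame01; `sum_abs_coeff_eq_len`, `mul_pow_le_of_lt_inv_pow`, `lt_two_pow_of_le_nat`, `half_pow_mul_two_lt`, `threshold_mono`, `den_eq_of_odd`, `not_algebraicIndependent_self`) with per-part private copies; `variable {ρ σ : ℝ}` (implicit binders only) kept; graded statements and proofs verbatim. `--supports stmt-Schanuel-24622`; no census credit carried; rung 0 — nothing here proves Schanuel; `KleinPolarSchanuel`, t(1,ρ_J)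 ≥ 5 NOT derived.)
-/

/-!
# RootDecomp1BExplicitPair — lens 4, generation 44 «AN EXPLICIT JOINTLY-ULTRA ALGEBRAICALLY INDEPENDENT PAIR
`(ρ_J, σ_J) ∈ JU`, BY A MEASURE-FREE INDEPENDENCE CRITERION (nested approximations on a common denominator)»

Unit `decomp-schanuel-lens-4-g44` · 2026-08-31 · HOME `decomp-schanuel-lens-4/g44/ExplicitPair.lean`.
RUNG 0: nothing in this file proves Schanuel's conjecture or the crux `KleinPolarSchanuel`; route-Schanuel-RootDecomp1B
(DRAFT rev 32) is UNCHANGED (no item / split / kind / closes / residual change; no ledger write).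

NODE OF RECORD.  `_root_.Schanuel` ⟸ X = `Summit.Schanuel.Schanuel.Theses.RootDecomp1B.KleinPolarSchanuel`
(stmt-Schanuel-24622: `∀ m (r : Fin m → ℝ), LinearIndependent ℚ r → m + m ≤ t(r)`, `t(r) = polarDeg r`).
This file is the optional THEOREM of critic VERDICT L2210 / RULE B-R29 (CLAIM L2220; ACK / CHECKLIST B-g44 L2225):
an EXPLICIT member of lens-4 g43's class `JU` (positive, jointly ultra-Liouville, algebraically independent pairs —
so far witnessed only generically, by Baire: g43 `exists_pos_pair`), with the algebraic independence PROVED by an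
effective, measure-free criterion.  NAMES: the CLAIM's `ρ⋆, σ⋆` are `ρ_J, σ_J` (`rhoJ`, `sigmaJ`) here, because the
tree meanwhile has lens-1's `RootDecomp1KSkelCell.rhoStar` (a different number) — no homonyms.

WHAT THIS FILE DECIDES (everything hypothesis-free; axioms `[propext, Classical.choice, Quot.sound]`):

* §2 **THE CRITERION** `algebraicIndependent_of_nestedLiouville : NestedLiouville ρ σ → AlgebraicIndependent ℚ ![ρ, σ]`,
  `NestedLiouville ρ σ := ∀ k, ∃ (q ≥ 2) (a b : ℤ), ρ ≠ a/q ∧ σ ≠ b/q ∧ |ρ − a/q| < q^{-k} ∧ |σ − b/q| < |ρ − a/q|^k`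
  (both coordinates Liouville; AT A COMMON DENOMINATOR the error of `σ` is below every power of the error of `ρ`);
  the sequence shape `algebraicIndependent_of_dominated_approx` and the weighted shape announced in the CLAIM
  `algebraicIndependent_of_dominated_approx_weighted`.  The ONE new estimate is §1 `eval_lower_near_rat`:
  `|η|^D / 2 ≤ q^D · |H((a+η)/q)|` for `H ∈ ℤ[X] ∖ 0`, `natDegree H ≤ D`, `a ∈ ℤ`, `q ≠ 0`, `|η| ≤ 1` and
  `|η| · (D+1) (2 max(1,|a|) q)^D len H ≤ 1/2` — valid EVEN WHEN `H(a/q) = 0`, through the integer re-expansion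
  coefficients `shiftCoeff` (`q^D H((a+η)/q) = Σ_k t_k η^k`), their non-vanishing (`exists_shiftCoeff_ne_zero`, from
  `Polynomial.eq_zero_of_infinite_isRoot`) and `lowest_term_dominates`.  Every other step of the criterion is a tree
  lemma of `RootDecomp1KHyper01` BY NAME (`transcendental_ofReal_of_liouville`, `exists_int_relation`,
  `exists_ball_eval_ne_zero`, `exists_lipschitz_at_root`, `specialise`, `aeval_specialise`, `natDegree_specialise_le`,
  `len_specialise_le`).
* §3 **THE EXPLICIT PAIR** `ρ_J := Σ_k 2^{-u_{2k}}`, `σ_J := Σ_k 2^{-u_{2k+1}}` over the TREE tower `uTow` of the named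
  member `ρ_U = Σ_k 2^{-u_k}` of `RootDecomp1BRadicalDescent06` (`rhoJ_add_sigmaJ : ρ_J + σ_J = ρ_U`): nested on the odd
  levels `K = 2k+1`, `q = 2^{u_K}` (`level_bounds`, `nestedLiouville_rhoJ_sigmaJ`; schedule `qSeq / aSeq / bSeq`,
  `dominated_approx_rhoJ_sigmaJ`), hence `algebraicIndependent_rhoJ_sigmaJ`; jointly ultra on the common denominators
  `2^{u_m}` (`jointlyUltra_rhoJ_sigmaJ`); **`JU_rhoJ_sigmaJ : JU ρ_J σ_J`** (§3.6: `UltraLiouville₂`, `JU` are LOCAL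
  VERBATIM COPIES of g43's definitions — g43's module `RootDecomp1BTwoStorey` is not in the tree at build time; the
  tree decls replace them at port); `exists_JU_explicit`.
* §4 each coordinate is in g30's class `UltraLiouville` (reduced denominators `2^{u_{2m}}`, `2^{u_{2m+1}}`) ⟹ the
  storey-two cells `t(1, ρ_J) ≥ 4`, `t(1, σ_J) ≥ 4` BY NAME (`RootDecomp1BFactDischarge.four_le_polarDeg_one_ultra`);
  the storey-three cell `t(1, ρ_J, σ_J) ≥ 6 = m + m` is g43's `six_le_polarDeg_one_pair JU_rhoJ_sigmaJ` once g43 is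
  ported (plug-fit shown in the probe file; ×0 bookkeeping).
* §5 CONTROLS PROVED: `NestedLiouville ρ ρ` and `NestedLiouville ρ ρ²` are false; ONE level of nesting, of any
  order, is insufficient (`frozen_level_insufficient`, a rational pair) — the `∀ k` is load-bearing.

POSITION.  The tree's `(ρ, σ)`-independence kernels are all MEASURE × APPROXIMATION: lens-6 `RootDecomp1KHyper02`
`algebraicIndependent_of_polyMeasure_liouville` (`PolyMeasure θ` × Liouville; Mahler `S × L`), `RootDecomp1KHyper17`
(weak measure × hyper-Liouville), lens-2 `RootDecomp1ETwoScale06/07` `algebraicIndependent_sigma_of_famMeasure` /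
`algebraicIndependent_tower_sigma` (`FamMeasure` at level `0` of a COVERED tower × `LogPowLiouville 19`) with the
hypothesis-free explicit pair `RootDecomp1ETwoScale08.algebraicIndependent_T₀σ₀` (two poly-log towers — Liouville,
NOT hyper-Liouville: `not_hyperLiouville_T₀ / σ₀`, so `(T₀, σ₀) ∉ JU`), lens-4 `ConjugateSieve`
`algebraicIndependent_zU_pair` (fed by LW).  HERE NO COORDINATE CARRIES A MEASURE — both are ultra-Liouville
(`|q ρ_J − a| < q · exp(−exp(q^m))` defeats every measure shape in the tree); the lever is the RELATIVE position of the
two approximations at the same denominator.  In print the shape is von Neumann 1928 / Perron (growth-separated gap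
series); what is claimed is the tree-novel kernel and the explicit `JU` member, not priority.
-/

noncomputable section

open Complex Filter Polynomial Finset

namespace Summit.Schanuel.Schanuel.Theorems.RootDecomp1BExplicitPair

open Summit.Schanuel.Schanuel.Theorems.RootDecomp1BTwoStorey (UltraLiouville₂ JU not_algebraicIndependent_sq)

open Summit.Schanuel.Schanuel.Theorems.RootDecomp1KHyper (len len_nonneg len_le_of_natDegree_le one_le_len
  abs_coeff_le_len exists_int_relation exists_ball_eval_ne_zero exists_lipschitz_at_root specialise
  aeval_specialise natDegree_specialise_le len_specialise_le transcendental_ofReal_of_liouville)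

/-! ## §1  The lower bound for an integer polynomial near a rational point -/

section NearRational

/-- The integer coefficients `t_k = Σ_{i ≤ D} h_i · C(i,k) · a^{i-k} · q^{D-i}` of the binomial re-expansion
`q^D · H((a + η)/q) = Σ_{k ≤ D} t_k η^k` (`H = Σ h_i X^i`, `deg H ≤ D`). -/
def shiftCoeff (H : ℤ[X]) (D : ℕ) (a : ℤ) (q : ℕ) (k : ℕ) : ℤ :=
  ∑ i ∈ range (D + 1), H.coeff i * (i.choose k : ℤ) * a ^ (i - k) * (q : ℤ) ^ (D - i)

/-- **The re-expansion identity** `q^D · H((a + η)/q) = Σ_{k ≤ D} t_k η^k`. -/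
theorem qpow_mul_aeval_eq (H : ℤ[X]) {D : ℕ} (hD : H.natDegree ≤ D) (a : ℤ) {q : ℕ} (hq : q ≠ 0)
    (η : ℝ) :
    (q : ℝ) ^ D * aeval (((a : ℝ) + η) / q) H =
      ∑ k ∈ range (D + 1), (shiftCoeff H D a q k : ℝ) * η ^ k := by
  have hqR : (q : ℝ) ≠ 0 := by exact_mod_cast hq
  have step : ∀ i ∈ range (D + 1), (q : ℝ) ^ D * (H.coeff i • (((a : ℝ) + η) / q) ^ i)
      = ∑ k ∈ range (D + 1),
          ((H.coeff i : ℝ) * (i.choose k : ℝ) * (a : ℝ) ^ (i - k) * (q : ℝ) ^ (D - i)) * η ^ k := by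
    intro i hi
    have hi' : i ≤ D := Nat.lt_succ_iff.mp (mem_range.mp hi)
    have hpow : ((a : ℝ) + η) ^ i = ∑ k ∈ range (D + 1), η ^ k * (a : ℝ) ^ (i - k) * (i.choose k : ℝ) := by
      rw [add_comm, add_pow]
      refine Finset.sum_subset (range_mono (by omega)) fun k hk hki => ?_
      have hik : i < k := by
        simp only [mem_range, not_lt] at hk hki
        omega
      rw [Nat.choose_eq_zero_of_lt hik, Nat.cast_zero, mul_zero]
    have hqD : (q : ℝ) ^ D = (q : ℝ) ^ (D - i) * (q : ℝ) ^ i := by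
      rw [← pow_add, Nat.sub_add_cancel hi']
    have hsc : (q : ℝ) ^ D * (H.coeff i • (((a : ℝ) + η) / q) ^ i)
        = (H.coeff i : ℝ) * (q : ℝ) ^ (D - i) * ((a : ℝ) + η) ^ i := by
      rw [zsmul_eq_mul, div_pow, hqD]
      field_simp
    rw [hsc, hpow, Finset.mul_sum]
    exact Finset.sum_congr rfl fun k _ => by ring
  rw [aeval_eq_sum_range' (Nat.lt_succ_of_le hD), Finset.mul_sum, Finset.sum_congr rfl step,
    Finset.sum_comm]
  refine Finset.sum_congr rfl fun k _ => ?_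
  rw [← Finset.sum_mul]
  congr 1
  push_cast [shiftCoeff]
  rfl

/-- Some re-expansion coefficient is non-zero (else `H` would vanish on all of `ℝ`). -/
theorem exists_shiftCoeff_ne_zero {H : ℤ[X]} (hH : H ≠ 0) {D : ℕ} (hD : H.natDegree ≤ D) (a : ℤ)
    {q : ℕ} (hq : q ≠ 0) : ∃ k ∈ range (D + 1), shiftCoeff H D a q k ≠ 0 := by
  by_contra h0
  push Not at h0
  apply hH
  have hqR : (q : ℝ) ≠ 0 := by exact_mod_cast hq
  have hroot : ∀ x : ℝ, aeval x H = 0 := by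
    intro x
    have h1 := qpow_mul_aeval_eq H hD a hq ((q : ℝ) * x - a)
    have hx : ((a : ℝ) + ((q : ℝ) * x - a)) / q = x := by
      field_simp
      ring
    rw [hx, Finset.sum_eq_zero (fun k hk => by rw [h0 k hk, Int.cast_zero, zero_mul])] at h1
    exact (mul_eq_zero.mp h1).resolve_left (pow_ne_zero _ hqR)
  have hmap : H.map (Int.castRingHom ℝ) = 0 := by
    apply Polynomial.eq_zero_of_infinite_isRoot
    have hset : {x : ℝ | (H.map (Int.castRingHom ℝ)).IsRoot x} = Set.univ := by
      ext x
      simp only [Set.mem_setOf_eq, Set.mem_univ, iff_true, IsRoot, eval_map, ← algebraMap_int_eq,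
        ← aeval_def]
      exact hroot x
    rw [hset]
    exact Set.infinite_univ
  exact (Polynomial.map_eq_zero_iff (Int.castRingHom ℝ).injective_int).mp hmap

/-- `Σ_{i ≤ D} |h_i| = len H` when `deg H ≤ D`. -/
private theorem sum_abs_coeff_eq_len (H : ℤ[X]) {D : ℕ} (hD : H.natDegree ≤ D) :
    ∑ i ∈ range (D + 1), |H.coeff i| = len H := by
  unfold len
  symm
  refine Finset.sum_subset (range_mono (by omega)) fun i hi hi' => ?_
  have hlt : H.natDegree < i := by
    simp only [mem_range, not_lt] at hi hi'
    omega
  rw [coeff_eq_zero_of_natDegree_lt hlt, abs_zero]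

/-- The size of the re-expansion coefficients: `|t_k| ≤ (2 · max(1,|a|) · q)^D · len H`. -/
theorem abs_shiftCoeff_le (H : ℤ[X]) {D : ℕ} (hD : H.natDegree ≤ D) (a : ℤ) {q : ℕ} (hq : q ≠ 0)
    (k : ℕ) :
    |(shiftCoeff H D a q k : ℝ)| ≤ (2 * max 1 |(a : ℝ)| * q) ^ D * (len H : ℝ) := by
  have hq1 : (1 : ℝ) ≤ q := by exact_mod_cast Nat.one_le_iff_ne_zero.mpr hq
  have hA1 : (1 : ℝ) ≤ max 1 |(a : ℝ)| := le_max_left _ _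
  have hlen : (len H : ℝ) = ∑ i ∈ range (D + 1), (|H.coeff i| : ℝ) := by
    rw [← sum_abs_coeff_eq_len H hD]
    push_cast
    rfl
  rw [hlen, Finset.mul_sum]
  unfold shiftCoeff
  push_cast
  refine (Finset.abs_sum_le_sum_abs _ _).trans (Finset.sum_le_sum fun i hi => ?_)
  have hi' : i ≤ D := Nat.lt_succ_iff.mp (mem_range.mp hi)
  rw [abs_mul, abs_mul, abs_mul, abs_pow, abs_pow, Nat.abs_cast, Nat.abs_cast]
  have hch : ((i.choose k : ℕ) : ℝ) ≤ (2 : ℝ) ^ D := by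
    have h1 : i.choose k ≤ 2 ^ D := (Nat.choose_le_two_pow i k).trans (Nat.pow_le_pow_right two_pos hi')
    exact_mod_cast h1
  have haP : |(a : ℝ)| ^ (i - k) ≤ (max 1 |(a : ℝ)|) ^ D :=
    (pow_le_pow_left₀ (abs_nonneg _) (le_max_right _ _) _).trans (pow_le_pow_right₀ hA1 (by omega))
  have hqP : (q : ℝ) ^ (D - i) ≤ (q : ℝ) ^ D := pow_le_pow_right₀ hq1 (by omega)
  calc |(H.coeff i : ℝ)| * ((i.choose k : ℕ) : ℝ) * |(a : ℝ)| ^ (i - k) * (q : ℝ) ^ (D - i)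
      ≤ |(H.coeff i : ℝ)| * (2 : ℝ) ^ D * (max 1 |(a : ℝ)|) ^ D * (q : ℝ) ^ D := by
        gcongr
    _ = (2 * max 1 |(a : ℝ)| * q) ^ D * |(H.coeff i : ℝ)| := by ring

/-- **Dominant lowest term.** For integers `t_0, …, t_d` not all zero and `|η| ≤ 1` with
`|η| · Σ_k |t_k| ≤ 1/2`: `|Σ_k t_k η^k| ≥ |η|^d / 2`. -/
theorem lowest_term_dominates : ∀ (d : ℕ) (t : ℕ → ℤ) (η : ℝ), |η| ≤ 1 → (∃ k ≤ d, t k ≠ 0) →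
    |η| * (∑ k ∈ range (d + 1), |(t k : ℝ)|) ≤ 1 / 2 →
    |η| ^ d / 2 ≤ |∑ k ∈ range (d + 1), (t k : ℝ) * η ^ k|
  | 0, t, η, _, ⟨k, hk, htk⟩, _ => by
      obtain rfl : k = 0 := Nat.le_zero.mp hk
      have h1 : (1 : ℝ) ≤ |(t 0 : ℝ)| := by
        rw [← Int.cast_abs]
        exact_mod_cast Int.one_le_abs htk
      simp only [zero_add, range_one, sum_singleton, pow_zero, mul_one]
      linarith
  | d + 1, t, η, hη, hex, hsmall => by
      have hη0 : 0 ≤ |η| := abs_nonneg η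
      -- split off the constant term
      have hsplit : ∑ k ∈ range (d + 1 + 1), (t k : ℝ) * η ^ k
          = η * (∑ k ∈ range (d + 1), (t (k + 1) : ℝ) * η ^ k) + t 0 := by
        rw [Finset.sum_range_succ', Finset.mul_sum, pow_zero, mul_one]
        refine congrArg (· + (t 0 : ℝ)) (Finset.sum_congr rfl fun k _ => by ring)
      have hsum_shift : ∑ k ∈ range (d + 1), |(t (k + 1) : ℝ)| ≤ ∑ k ∈ range (d + 1 + 1), |(t k : ℝ)| := by
        rw [Finset.sum_range_succ' (fun k => |(t k : ℝ)|)]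
        linarith [abs_nonneg (t 0 : ℝ)]
      have hsmall' : |η| * ∑ k ∈ range (d + 1), |(t (k + 1) : ℝ)| ≤ 1 / 2 :=
        (mul_le_mul_of_nonneg_left hsum_shift hη0).trans hsmall
      rw [hsplit]
      by_cases ht0 : t 0 = 0
      · -- the constant term vanishes: factor `η` and use the induction hypothesis
        obtain ⟨k, hk, htk⟩ := hex
        have hk0 : k ≠ 0 := by rintro rfl; exact htk ht0
        obtain ⟨k', rfl⟩ := Nat.exists_eq_succ_of_ne_zero hk0
        have ih := lowest_term_dominates d (fun k => t (k + 1)) η hη ⟨k', by omega, htk⟩ hsmall'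
        rw [ht0, Int.cast_zero, add_zero, abs_mul, pow_succ, mul_comm (|η| ^ d) |η|, mul_div_assoc]
        exact mul_le_mul_of_nonneg_left ih hη0
      · -- the constant term is a non-zero integer: it dominates
        set S : ℝ := ∑ k ∈ range (d + 1), (t (k + 1) : ℝ) * η ^ k with hSdef
        have h1 : (1 : ℝ) ≤ |(t 0 : ℝ)| := by
          rw [← Int.cast_abs]
          exact_mod_cast Int.one_le_abs ht0
        have hS : |S| ≤ ∑ k ∈ range (d + 1), |(t (k + 1) : ℝ)| := by
          refine (Finset.abs_sum_le_sum_abs _ _).trans (Finset.sum_le_sum fun k _ => ?_)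
          rw [abs_mul, abs_pow]
          exact mul_le_of_le_one_right (abs_nonneg _) (pow_le_one₀ hη0 hη)
        have hηS : |η * S| ≤ 1 / 2 := by
          rw [abs_mul]
          exact (mul_le_mul_of_nonneg_left hS hη0).trans hsmall'
        have hpow : |η| ^ (d + 1) ≤ 1 := pow_le_one₀ hη0 hη
        have htri : |(t 0 : ℝ)| - |η * S| ≤ |η * S + t 0| := by
          have := abs_sub_abs_le_abs_sub (t 0 : ℝ) (-(η * S))
          rw [abs_neg, sub_neg_eq_add] at this
          rwa [show η * S + (t 0 : ℝ) = (t 0 : ℝ) + η * S from add_comm _ _]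
        linarith

/-- **THE LOWER BOUND NEAR A RATIONAL POINT.** Let `H ∈ ℤ[X]`, `H ≠ 0`, `deg H ≤ D`, `a ∈ ℤ`, `q ≥ 1` and
`|η| ≤ 1` with `|η| · (D+1) · (2 q max(1,|a|))^D · len H ≤ 1/2`.  Then
`q^D · |H((a + η)/q)| ≥ |η|^D / 2` — an integer polynomial cannot be small at a point very close to
(but possibly equal to a root at) a rational `a/q`, beyond the order forced by its degree. -/
theorem eval_lower_near_rat {H : ℤ[X]} (hH : H ≠ 0) {D : ℕ} (hD : H.natDegree ≤ D) (a : ℤ) {q : ℕ}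
    (hq : q ≠ 0) {η : ℝ} (hη : |η| ≤ 1)
    (hsmall : |η| * (((D : ℝ) + 1) * (2 * max 1 |(a : ℝ)| * q) ^ D * (len H : ℝ)) ≤ 1 / 2) :
    |η| ^ D / 2 ≤ (q : ℝ) ^ D * |aeval (((a : ℝ) + η) / q) H| := by
  have h1 : (q : ℝ) ^ D * |aeval (((a : ℝ) + η) / q) H|
      = |∑ k ∈ range (D + 1), (shiftCoeff H D a q k : ℝ) * η ^ k| := by
    rw [← qpow_mul_aeval_eq H hD a hq η, abs_mul, abs_pow, Nat.abs_cast]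
  rw [h1]
  obtain ⟨k, hk, hne⟩ := exists_shiftCoeff_ne_zero hH hD a hq
  refine lowest_term_dominates D (shiftCoeff H D a q) η hη
    ⟨k, Nat.lt_succ_iff.mp (mem_range.mp hk), hne⟩ ((mul_le_mul_of_nonneg_left ?_ (abs_nonneg η)).trans hsmall)
  calc ∑ k ∈ range (D + 1), |(shiftCoeff H D a q k : ℝ)|
      ≤ ∑ _k ∈ range (D + 1), (2 * max 1 |(a : ℝ)| * q) ^ D * (len H : ℝ) :=
        Finset.sum_le_sum fun k _ => abs_shiftCoeff_le H hD a hq k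
    _ = ((D : ℝ) + 1) * (2 * max 1 |(a : ℝ)| * q) ^ D * (len H : ℝ) := by
        rw [Finset.sum_const, card_range, nsmul_eq_mul]
        push_cast
        ring

end NearRational

end Summit.Schanuel.Schanuel.Theorems.RootDecomp1BExplicitPair

end
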